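import Literature.MathematicalPhysics.QuantumFieldTheory.Balaban1983to89.Beta.TorusAdjointStencils
import Literature.MathematicalPhysics.QuantumFieldTheory.Balaban1983to89.Beta.OneBlockTorusUniqueness
import Literature.MathematicalPhysics.QuantumFieldTheory.Balaban1983to89.Beta.OneBlockTorusGauge

/-!
# Affine reproduction (H-aff) from covariance + the Euler–Lagrange system: the two-round theorem

HONEST FRAMING (cell rule, verbatim): «discharging BetaPertH makes Balaban's UV stability UNCONDITIONAL — a real
constructive-QFT result; it is NOT the continuum limit and NOT the Clay problem.»  This module is [folklore],
Mathlib-elementary; it is the kernel form of step (T1)/[H-germ′] «reading B» of the cell record `HOME/BETA/AN2.md` §11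
(Y12)–(Y15): NOTHING of the manuscripts under audit is asserted or cited as a fact.  The infinite-volume gauge-fixed
linearised minimiser of Bałaban (B5 (1.55)–(1.63) pp.26–29, B9 (3.20)–(3.23) p.394, B12 (3.3) pp.269–270 — CONTEXT
LOCATORS only) enters ONLY as the abstract, LABELLED hypothesis structure `InfiniteVolumeSpec` below (the cell's input
(O1′-cov)/(O1′-id)); whoever supplies an instance carries the analysis ((O1′-dom)).  NOT summit progress; NOT continuum,
NOT Clay.

THE STATEMENT.  Fix the block size `N ≥ 1` and work on `ℤ^d` with the stencils of `Beta.AffineAveraging` (`dz`, `curv`,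
`curvAdj`, `codiff₁`, the straight-contour block sum `contourSum N` =: 𝒬, un-normalised).  An `InfiniteVolumeSpec`
consists of three maps on coarse 1-forms — `H` (coarse data ↦ fine field), `Φ` (constraint multiplier, a coarse 1-form),
`Ψ` (gauge multiplier, a fine 0-form) — which on AFFINE coarse data are additive, BLOCK-TRANSLATION COVARIANT
(`H (b ∘ τ_a) = (H b) ∘ τ_{N a}`, `Φ (b ∘ τ_a) = (Φ b) ∘ τ_a`, `Ψ (b ∘ τ_a) = (Ψ b) ∘ τ_{N a}`) and satisfy the pointwise
Euler–Lagrange system of the constrained, weakly gauge-fixed quadratic problem: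
`𝒬 (H b) = b`, `curvAdj (curv (H b)) = 𝒬ᵀ (Φ b) + dz (Ψ b)`, and «`codiff₁ (dz (codiff₁ (H b)))` is block-constant»
(the weak gauge `R δ0 A = 0`, `R` = projection onto `Δ N(Q′)`, unfolded at `U = 1`).

THEOREM `hAff_of_spec`: for every such spec and every affine fine 1-form `A = affine m c`,  `H (𝒬 A) = A`  — exact
affine reproduction, (H-aff) of the cell record, with NO uniqueness / decay hypothesis: uniqueness is supplied by the
kernel theorems `OneBlockTorusKKT.oneBlock_kkt_trivial'` / `oneBlock_uniqueness_of_lap_gauge` on the ONE-BLOCK TORUS after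
periodic descent (`Beta.PeriodicDescent`, `Beta.TorusAdjointStencils`).  ROUND 1 (`round1`): constant data — the defect
`H (𝒬 c) − c` and the multipliers are `N`-periodic by covariance, descend to the torus, and the homogeneous torus system
forces them to vanish (so `Φ` kills constants and `Ψ` of a constant is constant).  ROUND 2: affine data — `A ∘ τ_{Na} = A +
constant`, so by additivity and Round 1 the defect is again periodic, `Φ b` is constant, `dz (Ψ b)` is periodic hence
`Ψ b` = periodic + linear (`exists_periodic_add_linear_of_dz_periodic`), the linear part contributing a constant 1-form
absorbed into `𝒬ᵀ` (`adjoint_Q_eq`); descend and conclude.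
-/

namespace Literature.MathematicalPhysics.QuantumFieldTheory.Balaban1983to89.Beta.AffineReproduction

open scoped InnerProductSpace
open Literature.Probability.LatticeModels (TorusSite Torus.proj Torus.proj_apply)
open AffineAveraging (Site Form0 Form1 Form2 unitVec unitVec_apply dz curv curvAdj codiff₁ affine box toSite blockSum contourSum
  curv_affine_eq curvAdj_curv_affine codiff₁_affine_eq contourSum_affine)
open PeriodicDescent OneBlockTorusKKT
open LatticeForm (repZ proj_repZ)

variable {d N : ℕ}

/-! ## §1 Vocabulary on `ℤ^d`: translations, constant 1-forms, the adjoint block sum, block-constancy, affinity -/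

/-- Translate a 0-form: `(trans0 a f)(x) = f (x + a)`. [folklore] -/
def trans0 (a : Site d) (f : Form0 d ℝ) : Form0 d ℝ := fun x => f (x + a)

/-- Translate a 1-form: `(trans1 a A)_κ(x) = A_κ(x + a)`. [folklore] -/
def trans1 (a : Site d) (A : Form1 d ℝ) : Form1 d ℝ := fun κ x => A κ (x + a)

/-- Entries of `trans0`. [folklore] -/
@[simp] theorem trans0_apply (a : Site d) (f : Form0 d ℝ) (x : Site d) : trans0 a f x = f (x + a) := rfl

/-- Entries of `trans1`. [folklore] -/
@[simp] theorem trans1_apply (a : Site d) (A : Form1 d ℝ) (κ : Fin d) (x : Site d) : trans1 a A κ x = A κ (x + a) := rfl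

/-- The constant 1-form with value `c κ` in direction `κ`. [folklore] -/
def cst (c : Fin d → ℝ) : Form1 d ℝ := fun κ _ => c κ

/-- Entries of `cst`. [folklore] -/
@[simp] theorem cst_apply (c : Fin d → ℝ) (κ : Fin d) (x : Site d) : cst c κ x = c κ := rfl

/-- The FORMAL ADJOINT of the straight-contour block sum `contourSum N` (collecting the coefficient of `A_κ(x)` in
`Σ_{κ,y} φ_κ(y) · (contourSum N A)_κ(y)`): `(𝒬ᵀ φ)_κ(x) = Σ_{s<N} φ_κ (block of (x − s e_κ))`, the block index being the
floor quotient by `N`. [folklore] -/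
def contourSumAdj (N : ℕ) (φ : Form1 d ℝ) : Form1 d ℝ :=
  fun κ x => ∑ s ∈ Finset.range N, φ κ (fun i => (x - (s : ℤ) • unitVec κ) i / (N : ℤ))

/-- On a coarse 1-form that is constant in the block variable, `𝒬ᵀ` is the constant fine 1-form `N · φ`. [folklore] -/
theorem contourSumAdj_of_const (φ : Form1 d ℝ) (hφ : ∀ κ y, φ κ y = φ κ 0) :
    contourSumAdj N φ = cst (fun κ => (N : ℝ) * φ κ 0) := by
  funext κ x
  simp only [contourSumAdj, cst_apply]
  rw [Finset.sum_congr rfl fun s _ => hφ κ _, Finset.sum_const, Finset.card_range, nsmul_eq_mul]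

/-- A 0-form is BLOCK-CONSTANT (for blocks of side `N`) if it takes the same value at all points of each block. [folklore] -/
def IsBlockConst (N : ℕ) (g : Form0 d ℝ) : Prop :=
  ∀ (y : Site d) (b : Fin d → ℕ), b ∈ box d N → g ((N : ℤ) • y + toSite b) = g ((N : ℤ) • y)

/-- A coarse 1-form is AFFINE if it is `affine m c` for some matrix `m` and vector `c`. [folklore] -/
def IsAffine (b : Form1 d ℝ) : Prop := ∃ (m : Fin d → Fin d → ℝ) (c : Fin d → ℝ), b = affine m c

/-- Constant 1-forms are affine. [folklore] -/
theorem isAffine_cst (c : Fin d → ℝ) : IsAffine (cst c : Form1 d ℝ) :=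
  ⟨0, c, by funext κ x; simp [affine, cst]⟩

/-- The block sum of an affine fine 1-form is an affine coarse 1-form. [folklore] -/
theorem isAffine_contourSum_affine (m : Fin d → Fin d → ℝ) (c : Fin d → ℝ) :
    IsAffine (contourSum N (affine m c)) :=
  ⟨_, _, contourSum_affine N m c⟩

/-- Sums of affine 1-forms are affine. [folklore] -/
theorem IsAffine.add {b b' : Form1 d ℝ} (hb : IsAffine b) (hb' : IsAffine b') : IsAffine (b + b') := by
  obtain ⟨m, c, rfl⟩ := hb
  obtain ⟨m', c', rfl⟩ := hb'
  refine ⟨m + m', c + c', ?_⟩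
  funext κ x
  simp only [Pi.add_apply, affine, Finset.sum_add_distrib, add_mul]
  ring

/-- Translating an affine 1-form adds a constant 1-form. [folklore] -/
theorem trans1_affine (z : Site d) (m : Fin d → Fin d → ℝ) (c : Fin d → ℝ) :
    trans1 z (affine m c) = affine m c + cst (fun κ => ∑ l, m κ l * (z l : ℝ)) := by
  funext κ x
  simp only [trans1_apply, affine, Pi.add_apply, cst_apply, Int.cast_add, mul_add, Finset.sum_add_distrib]
  ring

/-- Translates of affine 1-forms are affine. [folklore] -/
theorem IsAffine.trans1 {b : Form1 d ℝ} (hb : IsAffine b) (z : Site d) : IsAffine (trans1 z b) := by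
  obtain ⟨m, c, rfl⟩ := hb
  rw [trans1_affine]
  exact IsAffine.add ⟨m, c, rfl⟩ (isAffine_cst _)

/-- Constant 1-forms are translation invariant. [folklore] -/
@[simp] theorem trans1_cst (z : Site d) (c : Fin d → ℝ) : trans1 z (cst c : Form1 d ℝ) = cst c := rfl

/-! ## §2 Linearity and translation bookkeeping of the stencils -/

/-- `curv` is additive (difference form). [folklore] -/
theorem curv_sub (A B : Form1 d ℝ) : curv (A - B) = curv A - curv B := by
  funext κ l x; simp only [curv, Pi.sub_apply]; ring

/-- `curvAdj` is additive (difference form). [folklore] -/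
theorem curvAdj_sub (F G : Form2 d ℝ) : curvAdj (F - G) = curvAdj F - curvAdj G := by
  funext μ y; simp only [curvAdj, Pi.sub_apply, Finset.sum_sub_distrib]; ring

/-- `codiff₁` is additive (difference form). [folklore] -/
theorem codiff₁_sub (A B : Form1 d ℝ) : codiff₁ (A - B) = codiff₁ A - codiff₁ B := by
  funext x; simp only [codiff₁, Pi.sub_apply, Finset.sum_sub_distrib]; ring

/-- `dz` is additive (difference form). [folklore] -/
theorem dz_sub (f g : Form0 d ℝ) : dz (f - g) = dz f - dz g := by
  funext κ x; simp only [dz, Pi.sub_apply]; ring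

/-- `dz` is additive. [folklore] -/
theorem dz_add (f g : Form0 d ℝ) : dz (f + g) = dz f + dz g := by
  funext κ x; simp only [dz, Pi.add_apply]; ring

/-- `contourSum` is additive (difference form). [folklore] -/
theorem contourSum_sub (A B : Form1 d ℝ) : contourSum N (A - B) = contourSum N A - contourSum N B := by
  funext κ y; simp only [contourSum, Pi.sub_apply, Finset.sum_sub_distrib]

/-- `contourSum` is additive. [folklore] -/
theorem contourSum_add (A B : Form1 d ℝ) : contourSum N (A + B) = contourSum N A + contourSum N B := by
  funext κ y; simp only [contourSum, Pi.add_apply, Finset.sum_add_distrib]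

/-- `curvAdj 0 = 0`. [folklore] -/
theorem curvAdj_zero : curvAdj (0 : Form2 d ℝ) = 0 := by
  funext μ y; simp [curvAdj]

/-- Constant 1-forms are closed. [folklore] -/
theorem curv_cst (c : Fin d → ℝ) : curv (cst c : Form1 d ℝ) = 0 := by
  funext κ l x; simp [curv]

/-- Constant 1-forms are co-closed. [folklore] -/
theorem codiff₁_cst (c : Fin d → ℝ) : codiff₁ (cst c : Form1 d ℝ) = 0 := by
  funext x; simp [codiff₁]

/-- The gradient of a constant vanishes. [folklore] -/
theorem dz_const (t : ℝ) : dz (fun _ : Site d => t) = 0 := by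
  funext κ x; simp [dz]

/-- The gradient of a `ℤ`-linear 0-form is the constant 1-form of its slopes. [folklore] -/
theorem dz_linear (m : Fin d → ℝ) : dz (fun x : Site d => ∑ κ, (x κ : ℝ) * m κ) = cst m := by
  funext μ x
  simp only [dz, cst_apply, Pi.add_apply, unitVec_apply, Int.cast_add, add_mul, Finset.sum_add_distrib,
    add_sub_cancel_left]
  rw [Finset.sum_eq_single μ]
  · simp
  · intro κ _ hκ; simp [hκ]
  · intro h; exact absurd (Finset.mem_univ μ) h

/-- Block sums commute with block translations: `𝒬 (A ∘ τ_{N a}) = (𝒬 A) ∘ τ_a`. [folklore] -/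
theorem contourSum_trans1 (a : Site d) (A : Form1 d ℝ) :
    contourSum N (trans1 ((N : ℤ) • a) A) = trans1 a (contourSum N A) := by
  funext κ y
  simp only [contourSum, trans1_apply, smul_add]
  refine Finset.sum_congr rfl fun b _ => Finset.sum_congr rfl fun s _ => ?_
  congr 1; abel

/-- The Euler–Lagrange stencil commutes with translations. [folklore] -/
theorem curvAdj_curv_trans1 (a : Site d) (A : Form1 d ℝ) :
    curvAdj (curv (trans1 a A)) = trans1 a (curvAdj (curv A)) := by
  funext μ y
  simp only [curvAdj, curv, trans1_apply]
  refine congrArg₂ (· + ·) (Finset.sum_congr rfl fun l _ => ?_) (Finset.sum_congr rfl fun κ _ => ?_) <;>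
  · congr 1 <;> congr 1 <;> (try congr 1) <;> abel_nf

/-- A coarse 1-form invariant under all translations is constant in the block variable. [folklore] -/
theorem const_of_trans1_eq (φ : Form1 d ℝ) (h : ∀ a, trans1 a φ = φ) (κ : Fin d) (y : Site d) : φ κ y = φ κ 0 := by
  have := congrFun (congrFun (h y) κ) 0
  simpa using this

/-- Every lattice point is a block base point plus an offset in the box (floor decomposition). [folklore] -/
theorem exists_block_decomp [NeZero N] (x : Site d) :
    ∃ (y : Site d) (b : Fin d → ℕ), b ∈ box d N ∧ x = (N : ℤ) • y + toSite b := by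
  have hN : (0 : ℤ) < (N : ℤ) := by exact_mod_cast Nat.pos_of_ne_zero (NeZero.ne N)
  refine ⟨fun i => x i / (N : ℤ), fun i => (x i % (N : ℤ)).toNat, ?_, ?_⟩
  · simp only [box, Fintype.mem_piFinset, Finset.mem_range]
    intro i
    have h1 : x i % (N : ℤ) < (N : ℤ) := Int.emod_lt_of_pos _ hN
    have h2 : 0 ≤ x i % (N : ℤ) := Int.emod_nonneg _ hN.ne'
    omega
  · funext i
    have h2 : 0 ≤ x i % (N : ℤ) := Int.emod_nonneg _ hN.ne'
    simp only [Pi.add_apply, Pi.smul_apply, smul_eq_mul, toSite, Int.toNat_of_nonneg h2]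
    linarith [Int.mul_ediv_add_emod (x i) (N : ℤ)]

/-- A block-constant `N`-periodic 0-form is constant. [folklore] -/
theorem const_of_blockConst_periodic [NeZero N] (g : Form0 d ℝ) (hb : IsBlockConst N g) (hp : IsPeriodic N g)
    (x : Site d) : g x = g 0 := by
  obtain ⟨y, b, hbox, rfl⟩ := exists_block_decomp (N := N) x
  rw [hb y b hbox]
  have := hp 0 y
  rwa [zero_add] at this

/-! ## §3 The labelled hypothesis structure (O1′-cov)/(O1′-id) -/

/-- **`InfiniteVolumeSpec d N`** — the cell's LABELLED analysis input (O1′) about ONE object, as pointwise algebra: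
maps `H` (coarse 1-form ↦ fine 1-form: "the gauge-fixed linearised minimiser with prescribed block averages"), `Φ`
(constraint multiplier, coarse 1-form) and `Ψ` (gauge multiplier, fine 0-form) which, ON AFFINE COARSE DATA, are additive,
block-translation covariant, reproduce the data under the block sum, and satisfy the Euler–Lagrange identity of
`½‖curv A‖²` with constraint term `𝒬ᵀ Φ` and gauge term `dz Ψ`, plus the WEAK gauge condition «`codiff₁ (dz (codiff₁ (H b)))`
block-constant».  No uniqueness, decay or domain statement is part of the structure (those are the supplier's burden,
(O1′-dom)); nothing here is asserted to hold for Bałaban's operators — an instance is a HYPOTHESIS of the wall. [folklore] -/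
structure InfiniteVolumeSpec (d N : ℕ) where
  /-- fine field with prescribed coarse data -/
  H : Form1 d ℝ → Form1 d ℝ
  /-- constraint multiplier (coarse 1-form) -/
  Φ : Form1 d ℝ → Form1 d ℝ
  /-- gauge multiplier (fine 0-form) -/
  Ψ : Form1 d ℝ → Form0 d ℝ
  H_add : ∀ b b', IsAffine b → IsAffine b' → H (b + b') = H b + H b'
  Φ_add : ∀ b b', IsAffine b → IsAffine b' → Φ (b + b') = Φ b + Φ b'
  Ψ_add : ∀ b b', IsAffine b → IsAffine b' → Ψ (b + b') = Ψ b + Ψ b'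
  H_cov : ∀ b (a : Site d), IsAffine b → H (trans1 a b) = trans1 ((N : ℤ) • a) (H b)
  Φ_cov : ∀ b (a : Site d), IsAffine b → Φ (trans1 a b) = trans1 a (Φ b)
  Ψ_cov : ∀ b (a : Site d), IsAffine b → Ψ (trans1 a b) = trans0 ((N : ℤ) • a) (Ψ b)
  Q_H : ∀ b, IsAffine b → contourSum N (H b) = b
  EL : ∀ b, IsAffine b → curvAdj (curv (H b)) = contourSumAdj N (Φ b) + dz (Ψ b)
  gauge : ∀ b, IsAffine b → IsBlockConst N (codiff₁ (dz (codiff₁ (H b))))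

/-! ## §4 The descent lemma: a periodic solution of the one-block-data system on `ℤ^d` vanishes -/

/-- **DESCENT LEMMA.**  Let `E` be an `N`-periodic 1-form on `ℤ^d` with `curvAdj (curv E) = cst φ0 + dz p` for a constant
1-form `cst φ0` and an `N`-periodic 0-form `p`, with zero block sums, and with `codiff₁ (dz (codiff₁ E))` block-constant.
Then `E = 0`, `φ0 = 0` and `dz p = 0` — by descent to the one-block torus (`TorusAdjointStencils`) and the unconditional
torus theorems `oneBlock_uniqueness_of_lap_gauge` (with `hdg_holds`), `gauge_descent`, `oneBlock_kkt_trivial'`. [folklore] -/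
theorem descent [NeZero N] (E : Form1 d ℝ) (hE : IsPeriodic1 N E) (φ0 : Fin d → ℝ) (p : Form0 d ℝ)
    (hp : IsPeriodic N p) (hEL : curvAdj (curv E) = cst φ0 + dz p) (hQ : ∀ κ, contourSum N E κ 0 = 0)
    (hG : IsBlockConst N (codiff₁ (dz (codiff₁ E)))) : E = 0 ∧ φ0 = 0 ∧ dz p = 0 := by
  have hNr : (N : ℝ) ≠ 0 := by exact_mod_cast NeZero.ne N
  -- descend the data
  set Et : Fin d → 𝕋 d N → ℝ := fun κ z => E κ (repZ z) with hEt_def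
  set pt : 𝕋 d N → ℝ := fun z => p (repZ z) with hpt_def
  have hE' : E = lift1 N Et := eq_lift1_of_isPeriodic1 E hE
  have hp' : p = lift0 N pt := eq_lift0_of_isPeriodic p hp
  set D : C1 d N := pack1 Et with hD
  set ψv : C0 d N := pack0 pt with hψv
  set φv : W d := mk fun κ => φ0 κ / (N : ℝ) with hφv
  -- stationarity on the torus
  have hstat : LinearMap.adjoint d1 (d1 D) = LinearMap.adjoint Q φv + d0 ψv := by
    have h1 : lift1 N (fun μ y => LinearMap.adjoint d1 (d1 D) (μ, y))
        = lift1 N (fun μ y => (LinearMap.adjoint Q φv + d0 ψv : C1 d N) (μ, y)) := by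
      rw [← curvAdj_curv_lift1_pack, ← hE', hEL]
      funext μ x
      simp only [lift1_apply, PiLp.add_apply, adjoint_Q_apply, mk_apply, hφv, mul_div_cancel₀ _ hNr]
      rw [hp', dz_lift0_pack]
      simp [hψv]
    have h2 := lift1_injective h1
    ext ⟨μ, z⟩
    exact congrFun (congrFun h2 μ) z
  -- constraint on the torus
  have hQ' : Q D = 0 := by
    ext κ
    rw [hD, ← contourSum_lift1_pack Et κ 0, ← hE']
    simpa using hQ κ
  -- weak gauge on the torus
  have hg' : d0 (LinearMap.adjoint d0 (d0 (LinearMap.adjoint d0 D))) = 0 := by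
    set v : 𝕋 d N → ℝ := fun y => LinearMap.adjoint d0 D y with hv
    have hcod : codiff₁ E = lift0 N v := by rw [hE', codiff₁_lift1_pack]
    have hper : IsPeriodic N (codiff₁ (dz (codiff₁ E))) := by
      rw [hcod, dz_lift0_pack, codiff₁_lift1_pack]; exact isPeriodic_lift0 _
    have hconst := const_of_blockConst_periodic _ hG hper
    have key := d0_lap_pack_eq_zero_of_const v (codiff₁ (dz (codiff₁ E)) 0) (fun x => by rw [← hcod]; exact hconst x)
    have hpv : pack0 v = LinearMap.adjoint d0 D := by ext y; simp [hv]
    rwa [hpv] at key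
  -- the torus theorems
  have hfull : LinearMap.adjoint d0 D = 0 := gauge_descent D hg'
  obtain ⟨hD0, hφ, hψ⟩ := oneBlock_kkt_trivial' hstat hQ' hfull
  refine ⟨?_, ?_, ?_⟩
  · rw [hE']
    funext κ x
    have : D (κ, Torus.proj N x) = 0 := by rw [hD0]; rfl
    simpa [hD] using this
  · funext κ
    have : φv κ = 0 := by rw [hφ]; rfl
    simp only [hφv, mk_apply, div_eq_zero_iff, hNr, or_false] at this
    exact this
  · rw [hp', dz_lift0_pack]
    funext κ x
    have : d0 ψv (κ, Torus.proj N x) = 0 := by rw [hψ]; rfl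
    simpa [hψv] using this

/-! ## §5 Round 1: constants -/

/-- **ROUND 1**: for constant fine data `cst c`, the spec reproduces it exactly, its constraint multiplier vanishes and
its gauge multiplier is a constant. [folklore] -/
theorem round1 [NeZero N] (S : InfiniteVolumeSpec d N) (c : Fin d → ℝ) :
    S.H (contourSum N (cst c)) = cst c ∧ S.Φ (contourSum N (cst c)) = 0 ∧ dz (S.Ψ (contourSum N (cst c))) = 0 := by
  set b : Form1 d ℝ := contourSum N (cst c) with hb
  have hba : IsAffine b := by
    have : (cst c : Form1 d ℝ) = affine 0 c := by funext κ x; simp [affine, cst]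
    rw [hb, this]; exact isAffine_contourSum_affine 0 c
  have hbt : ∀ a : Site d, trans1 a b = b := by
    intro a; rw [hb, ← contourSum_trans1, trans1_cst]
  -- periodicity of the defect and of the multipliers
  set E : Form1 d ℝ := S.H b - cst c with hE
  have hEper : IsPeriodic1 N E := by
    intro κ x a
    have h := S.H_cov b a hba
    rw [hbt] at h
    have := congrFun (congrFun h κ) x
    simp only [trans1_apply] at this
    simp [hE, this]
  have hΦc : ∀ κ y, S.Φ b κ y = S.Φ b κ 0 :=
    const_of_trans1_eq _ (fun a => by rw [← S.Φ_cov b a hba, hbt])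
  have hΨper : IsPeriodic N (S.Ψ b) := by
    intro x a
    have h := S.Ψ_cov b a hba
    rw [hbt] at h
    have := congrFun h x
    simp only [trans0_apply] at this
    exact this.symm
  -- the three equations for the defect
  have hEL : curvAdj (curv E) = cst (fun κ => (N : ℝ) * S.Φ b κ 0) + dz (S.Ψ b) := by
    rw [hE, curv_sub, curvAdj_sub, curv_cst, curvAdj_zero, sub_zero, S.EL b hba, contourSumAdj_of_const _ hΦc]
  have hQ : ∀ κ, contourSum N E κ 0 = 0 := by
    intro κ
    rw [hE, contourSum_sub, S.Q_H b hba, hb]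
    simp
  have hG : IsBlockConst N (codiff₁ (dz (codiff₁ E))) := by
    rw [hE, codiff₁_sub, codiff₁_cst, sub_zero]; exact S.gauge b hba
  obtain ⟨h1, h2, h3⟩ := descent E hEper _ _ hΨper hEL hQ hG
  refine ⟨?_, ?_, h3⟩
  · rw [hE] at h1; exact sub_eq_zero.1 h1
  · funext κ y
    rw [hΦc]
    have := congrFun h2 κ
    simp only [Pi.zero_apply, mul_eq_zero] at this
    rcases this with h | h
    · exact absurd h (by exact_mod_cast NeZero.ne N)
    · simpa using h

/-! ## §6 Round 2: affine data — the theorem -/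

/-- **(H-aff) — EXACT AFFINE REPRODUCTION.**  For every `InfiniteVolumeSpec` and every affine fine 1-form
`A = affine m c`:  `H (𝒬 A) = A`. [folklore] -/
theorem hAff_of_spec [NeZero N] (S : InfiniteVolumeSpec d N) (m : Fin d → Fin d → ℝ) (c : Fin d → ℝ) :
    S.H (contourSum N (affine m c)) = affine m c := by
  set A : Form1 d ℝ := affine m c with hA
  set b : Form1 d ℝ := contourSum N A with hb
  have hba : IsAffine b := isAffine_contourSum_affine m c
  -- translation of the data: `b ∘ τ_a = b + k_a`, `k_a = 𝒬 (cst c_a)`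
  set ca : Site d → Fin d → ℝ := fun a κ => ∑ l, m κ l * ((((N : ℤ) • a) l : ℤ) : ℝ) with hca
  have hAt : ∀ a : Site d, trans1 ((N : ℤ) • a) A = A + cst (ca a) := fun a => by
    rw [hA, trans1_affine]
  set k : Site d → Form1 d ℝ := fun a => contourSum N (cst (ca a)) with hk
  have hka : ∀ a, IsAffine (k a) := fun a => by
    have : (cst (ca a) : Form1 d ℝ) = affine 0 (ca a) := by funext κ x; simp [affine, cst]
    simp only [hk]; rw [this]; exact isAffine_contourSum_affine 0 _
  have hbt : ∀ a : Site d, trans1 a b = b + k a := by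
    intro a; rw [hb, ← contourSum_trans1, hAt, contourSum_add]
  -- Round 1 on the constants `ca a`
  have hR1 : ∀ a, S.H (k a) = cst (ca a) ∧ S.Φ (k a) = 0 ∧ dz (S.Ψ (k a)) = 0 := fun a => round1 S (ca a)
  -- periodicity of the defect
  set E : Form1 d ℝ := S.H b - A with hE
  have hEper : IsPeriodic1 N E := by
    intro κ x a
    have h := S.H_cov b a hba
    rw [hbt, S.H_add _ _ hba (hka a), (hR1 a).1] at h
    have h' := congrFun (congrFun h κ) x
    have hA' := congrFun (congrFun (hAt a) κ) x
    simp only [trans1_apply, Pi.add_apply, cst_apply] at h' hA'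
    simp only [hE, Pi.sub_apply, hA', ← h']
    ring
  -- the constraint multiplier is constant
  have hΦc : ∀ κ y, S.Φ b κ y = S.Φ b κ 0 :=
    const_of_trans1_eq _ (fun a => by rw [← S.Φ_cov b a hba, hbt, S.Φ_add _ _ hba (hka a), (hR1 a).2.1, add_zero])
  -- the gauge multiplier has periodic gradient, hence is periodic + linear
  have hΨ : ∃ (m' : Fin d → ℝ) (q : Form0 d ℝ), IsPeriodic N q ∧ ∀ x, S.Ψ b x = q x + ∑ κ, (x κ : ℝ) * m' κ := by
    refine exists_periodic_add_linear_of_dz_periodic (S.Ψ b) fun κ x a => ?_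
    have h := S.Ψ_cov b a hba
    rw [hbt, S.Ψ_add _ _ hba (hka a)] at h
    -- `Ψ b (x + N a) = Ψ b x + Ψ (k a) x`, and `Ψ (k a)` is constant
    have hx : ∀ z, S.Ψ b (z + (N : ℤ) • a) = S.Ψ b z + S.Ψ (k a) z := fun z => by
      have := congrFun h z; simpa using this.symm
    have hc : S.Ψ (k a) (x + unitVec κ) = S.Ψ (k a) x := by
      have := congrFun (congrFun (hR1 a).2.2 κ) x
      simpa [dz, sub_eq_zero] using this
    simp only [dz]
    rw [add_right_comm, hx, hx, hc]
    ring
  obtain ⟨m', q, hq, hΨq⟩ := hΨ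
  have hdzΨ : dz (S.Ψ b) = dz q + cst m' := by
    have : S.Ψ b = q + fun x => ∑ κ, (x κ : ℝ) * m' κ := by funext x; simp [hΨq]
    rw [this, dz_add, dz_linear]
  -- the three equations for the defect
  have hEL : curvAdj (curv E) = cst (fun κ => (N : ℝ) * S.Φ b κ 0 + m' κ) + dz q := by
    rw [hE, curv_sub, curvAdj_sub, S.EL b hba, contourSumAdj_of_const _ hΦc, hdzΨ, hA, curvAdj_curv_affine]
    funext κ x
    simp only [Pi.sub_apply, Pi.add_apply, cst_apply, Pi.zero_apply]
    ring
  have hQ : ∀ κ, contourSum N E κ 0 = 0 := by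
    intro κ
    rw [hE, contourSum_sub, S.Q_H b hba, hb]
    simp
  have hG : IsBlockConst N (codiff₁ (dz (codiff₁ E))) := by
    have h0 : dz (codiff₁ A) = 0 := by rw [hA, codiff₁_affine_eq]; exact dz_const _
    rw [hE, codiff₁_sub, dz_sub, h0, sub_zero]
    exact S.gauge b hba
  obtain ⟨h1, -, -⟩ := descent E hEper _ _ hq hEL hQ hG
  rw [hE] at h1
  exact sub_eq_zero.1 h1

/-- COROLLARY in the shape of the cell record: with `E x := H (𝒬 x) − x`, the defect vanishes on every affine fine field —
the hypothesis `hTU` of `TorusKKTUniqueness.affine_reproduction_of_covariance` DISCHARGED. [folklore] -/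
theorem defect_affine_eq_zero [NeZero N] (S : InfiniteVolumeSpec d N) (m : Fin d → Fin d → ℝ) (c : Fin d → ℝ) :
    S.H (contourSum N (affine m c)) - affine m c = 0 :=
  sub_eq_zero.2 (hAff_of_spec S m c)

/-! ## §7 Consistency witness -/

/-- For block side `1` every 0-form is block-constant (blocks are single sites). [folklore] -/
theorem isBlockConst_one (g : Form0 d ℝ) : IsBlockConst 1 g := by
  intro y b hb
  have hb0 : b = fun _ => 0 := by
    funext i
    simp only [box, Fintype.mem_piFinset, Finset.mem_range, Nat.lt_one_iff] at hb
    exact hb i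
  subst hb0
  have : (toSite (fun _ : Fin d => (0 : ℕ)) : Site d) = 0 := by funext i; simp [toSite]
  rw [this, add_zero]

/-- For block side `1` the block sum is the identity. [folklore] -/
theorem contourSum_one (A : Form1 d ℝ) : contourSum 1 A = A := by
  funext κ y
  have hbox : box d 1 = {fun _ => 0} := by
    ext b
    simp only [box, Fintype.mem_piFinset, Finset.mem_range, Nat.lt_one_iff, Finset.mem_singleton, funext_iff]
  have h0 : (toSite (fun _ : Fin d => (0 : ℕ)) : Site d) = 0 := by funext i; simp [toSite]
  simp [contourSum, hbox, h0]

/-- **CONSISTENCY WITNESS** (`N = 1`: blocks are single sites, `𝒬 = id`, `H = id`, both multipliers zero): the hypothesis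
structure `InfiniteVolumeSpec` is not contradictory.  It says NOTHING about `N ≥ 2`, where an instance is exactly the
cell's analysis input (O1′). [folklore] -/
def pointSpec (d : ℕ) : InfiniteVolumeSpec d 1 where
  H := fun b => b
  Φ := fun _ => 0
  Ψ := fun _ => 0
  H_add := fun _ _ _ _ => rfl
  Φ_add := fun _ _ _ _ => by simp
  Ψ_add := fun _ _ _ _ => by simp
  H_cov := fun b a _ => by simp
  Φ_cov := fun _ _ _ => rfl
  Ψ_cov := fun _ _ _ => rfl
  Q_H := fun b _ => contourSum_one b
  EL := fun b hb => by
    obtain ⟨m, c, rfl⟩ := hb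
    rw [curvAdj_curv_affine]
    funext κ x
    simp [contourSumAdj, dz]
  gauge := fun b _ => isBlockConst_one _

end Literature.MathematicalPhysics.QuantumFieldTheory.Balaban1983to89.Beta.AffineReproduction
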